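import Literature.Probability.RandomPlanarGeometry.HexSAWStripWidthThreeContactAsymptotics
import Literature.Probability.RandomPlanarGeometry.HexSAWStripWidthTwoContactVariance
import HarnessLib

/-!
# The width-three strip at criticality: the VARIANCE of the number of surface contacts of a long bridge is LINEAR in the length,
# with the explicit universal rate `σ̂₃² = c₂ − c²` per hat index, `σ₃² = σ̂₃²/2 = 0.2756937808…` per step
# (module «WIDTH-THREE CONTACT VARIANCE»)

Topic `Literature/Probability/RandomPlanarGeometry` (continues «WIDTH-THREE CONTACT ASYMPTOTICS» — `W3.limDThree` (`A > 0`), `W3.cThree`, `W3.linQThree`,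
`W3.exists_hatC2D_three_quadratic`, the five scalars `W3.tOneThree … W3.tyyThree` of `det P` at `(1, y₃)` —, «WIDTH-THREE HAT ANNIHILATOR» #1457 and the lane
plumbing `W2.tendsto_ratio_var_sub_linear` of «WIDTH-TWO CONTACT VARIANCE RATE» (the variance algebra of a linear variance law)).  Lane «pcv-sawmu»
(CriticalPhenomena venture), a-p2 g29 — the last step of the width-three contact-VARIANCE programme (HANDOFF a-p2 g27/g28; PREREG Am. BO cell BO-9K).
Setting: W. Feller I (1968) XIII.6 (`Var N_k = (σ²/μ³)k + O(1)` for a scalar renewal process); H. Duminil-Copin, A. Hammond, CMP 324 (2013) §2.2 (bridge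
decomposition).  The strip `S₃` is a six-type matrix renewal whose irreducible kernel is NOT finitely supported (two serpentine families); the constants below are
its explicit instance.  Nothing below is printed.

THE FORMULA.  With `T(λ, y) = det P(λ; y) = Σ_r t_r(y)λ^r` the annihilating polynomial of the hat recursion (#1457) and, at `(λ, y) = (1, y₃)`,
`T_λ = Σ r t_r`, `T_λλ = Σ r(r−1)t_r`, `T_y = Σ ṫ_r`, `T_λy = Σ rṫ_r`, `T_yy = Σ ẗ_r` (`ṫ = y∂_y t`): the Perron root `λ(y)` per hat index has
`c := y₃λ′(y₃) = −T_y/T_λ` and `c₂ := (y∂_y)²λ (y₃) = −(T_λλc² + 2cT_λy + T_yy)/T_λ` (implicit differentiation), and the variance rate per hat index is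
`σ̂₃² = (y∂_y)² log λ = c₂ − c²`.  Numerically (kit `HOME/pub-sawmu-a-p2/g29/kit/sigma_check.py`, 60 digits from the integer table of «CONTACT ANNIHILATOR»):
`T_λ = 0.459758515`, `T_λλ = 22.53677982`, `T_y = −0.303781549`, `T_λy = −7.772453382`, `T_yy = −0.0221540127`, `c = 0.66074154074086614410 = 2θ₃`,
`σ̂₃² = 0.55138756172718221664`, **`σ₃² = σ̂₃²/2 = 0.27569378086359110832`** — the value MINED by a-p2 g27 (`FINDING-WIDTH-THREE-CONTACT-VARIANCE-CONJECTURE.md`,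
renewal + forward AD; exact sextic) and REPLICATED by two non-author devices (PREREG Am. BO, 8/8 TRUE); here it is PROVED as the variance rate.

## What is proved (namespace `…SAW.HV.W3`; `y₃ = stripYT 3`, `A = limDThree`)

* §1 `cTwoThree` (`c₂`), ★ `varRateHatThree = c₂ − c²` (`σ̂₃²`), ★ `sigmaSqThree = σ̂₃²/2` (`σ₃²`); `meanTopThree`, `varTopThree` (mean and variance of the
  number of surface contacts of an `S₃` bridge `a → b` of hat index `k` under the critical weights, as ratios of `Ĉ`, `Ĉ²`, `D̂`).
* §2 The three inputs of the variance algebra: `tendsto_sq_mul_hatD_three_sub`, and (inside the main proof) the first/second-order laws of «CONTACT ASYMPTOTICS»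
  re-indexed by `k+1`; ★ `varRate_identity_three` — `(ℓA − 2μ₁μ₀)/A² = c₂ − c²` for the constants of ANY level pair (the intercepts cancel).
* §3 ★★★ **`tendsto_varTopThree_sub_linear (a b)`**: `∃ V, varTopThree (k+1) a b − σ̂₃²·(k+1) → V` — THE VARIANCE OF THE CONTACT COUNT IS LINEAR IN THE LENGTH WITH
  THE UNIVERSAL EXPLICIT SLOPE `σ̂₃² = c₂ − c²`; corollaries `tendsto_varTopThree_succ_sub` (increments → `σ̂₃²`), `tendsto_varTopThree_div` (`Var_k/k → σ̂₃²`),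
  ★★★ **`tendsto_varTopThree_div_hatLen`** (`Var/(number of steps) → σ₃² = σ̂₃²/2` — cell BO-9K of the lane register); ★ `tendsto_meanTopThree_div_hatLen`
  (`mean/(number of steps) → c/2`, the contact density, cf. «WIDTH-THREE-DENSITY» `θ₃ = 0.3303707704`).

Label: LANE THEOREM (own result of lane «pcv-sawmu», a-p2 g29 with the g27/g28 programme, 2026-08-28; not in print).  NOT claimed: a closed form of the intercept
`V`; the algebraic identification of `σ₃²` with the FINDING's degree-six number / an enclosure (kit check only, next module); the identity `c/2 = thetaThree`
of «WIDTH-THREE-DENSITY» (numerically equal to 20 digits); a central limit theorem; anything at `T ≥ 4`.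
-/

noncomputable section

open Finset Filter Topology Matrix Literature.Probability.LatticeModels Literature.Probability.Percolation

namespace Literature.Probability.RandomPlanarGeometry.SAW

namespace HV

namespace W3

/-! ## §1 The constants and the statistics -/

/-- `c₂ := −(T_λλ·c² + 2c·T_λy + T_yy)/T_λ` — the second logarithmic `y`-derivative datum `(y∂_y)²λ(y₃)` of the Perron root per hat index
(implicit differentiation of `det P(λ(y); y) = 0` twice). [cite: Feller1968, XIII.6; lane «pcv-sawmu» a-p2 g29] -/
def cTwoThree : ℝ := -(tTwoThree * cThree ^ 2 + 2 * cThree * tlyThree + tyyThree) / tOneThree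

/-- ★ `σ̂₃² := c₂ − c²` — the variance rate of the surface-contact count PER HAT INDEX (`= (y∂_y)² log λ(y₃)`; numerically `0.5513875617`).
[cite: Feller1968, XIII.6 (`Var N_k ∼ (σ²/μ³)k`); lane «pcv-sawmu» a-p2 g29] -/
def varRateHatThree : ℝ := cTwoThree - cThree ^ 2

/-- ★ `σ₃² := σ̂₃²/2` — the variance rate PER STEP (two steps per hat index; numerically `0.2756937808635911…`, the FINDING's degree-six algebraic number).
[cite: Feller1968, XIII.6; DuminilCopinHammond2013, §2.2; lane «pcv-sawmu» a-p2 g27/g29] -/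
def sigmaSqThree : ℝ := varRateHatThree / 2

/-- The mean number of surface contacts of a bridge `a → b` of `S₃` with hat index `k` under the critical weights `x_c^{#steps} y₃^{#top}`:
`Ĉ(k)_{ab}/D̂(k)_{ab}`. [cite: Feller1968, XIII.6; DuminilCopinHammond2013, §2.2; lane «pcv-sawmu» a-p2 g29] -/
def meanTopThree (k : ℕ) (a b : Fin (2 * 3)) : ℝ := hatCD (stripYT 3) k a b / hatD 3 (stripYT 3) k a b

/-- The variance of the number of surface contacts of a bridge `a → b` of `S₃` with hat index `k` under the critical weights:
`Ĉ²(k)_{ab}/D̂(k)_{ab} − (Ĉ(k)_{ab}/D̂(k)_{ab})²`. [cite: Feller1968, XIII.6; DuminilCopinHammond2013, §2.2; lane «pcv-sawmu» a-p2 g29] -/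
def varTopThree (k : ℕ) (a b : Fin (2 * 3)) : ℝ := hatC2D (stripYT 3) k a b / hatD 3 (stripYT 3) k a b - meanTopThree k a b ^ 2

/-! ## §2 The inputs of the variance algebra -/

/-- `(k+1)²·(D̂(k+1)_{ab} − A_{ab}) → 0` (geometric convergence beats any polynomial; #1457). [cite: Feller1968, XIII.10; lane plumbing] -/
theorem tendsto_sq_mul_hatD_three_sub (a b : Fin (2 * 3)) :
    Tendsto (fun k : ℕ => ((k : ℝ) + 1) ^ 2 * (hatD 3 (stripYT 3) (k + 1) a b - limDThree a b)) atTop (𝓝 0) := by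
  obtain ⟨K, hK⟩ := abs_hatD_three_sub_lim_le
  exact Literature.Analysis.tendsto_succ_pow_mul_of_abs_le (e := fun n => hatD 3 (stripYT 3) (n + 1) a b - limDThree a b)
    (by norm_num : (0 : ℝ) < 97 / 100) (by norm_num) (fun n => hK a b n) 2

/-- ★ **The variance-rate identity** (the intercepts cancel): for every `A ≠ 0` and every `m₀`, with `μ₁ = cA`, `μ₀ = m₀ − cA`, `q = c²A`,
`ℓ = linQThree A m₀ − 2c²A`: `(ℓA − 2μ₁μ₀)/A² = c₂ − c² = σ̂₃²` — the slope of the variance law does not depend on the level pair nor on the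
first-order intercept (uses `c·T_λ = −T_y`, `T_λ ≠ 0`). [cite: Feller1968, XIII.6; lane «pcv-sawmu» a-p2 g29 — own] -/
theorem varRate_identity_three (hT : tOneThree ≠ 0) {A : ℝ} (hA : A ≠ 0) (m₀ : ℝ) :
    ((linQThree A m₀ - 2 * cThree ^ 2 * A) * A - 2 * (cThree * A) * (m₀ - cThree * A)) / A ^ 2 = varRateHatThree := by
  have hty : tyThree = -(cThree * tOneThree) := by
    have : cThree * tOneThree = -tyThree := by rw [cThree]; field_simp
    linarith
  rw [varRateHatThree, cTwoThree, linQThree, hty]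
  field_simp
  ring

/-! ## §3 The variance law -/

/-- ★★★ **THE WIDTH-THREE CONTACT VARIANCE LAW.**  For every pair of levels `a, b` there is an intercept `V` with
`varTopThree (k+1) a b − σ̂₃²·(k+1) → V`, `σ̂₃² = varRateHatThree = c₂ − c²`: the variance of the number of surface contacts of a critical `S₃` bridge is
LINEAR in the hat index with a universal (level-independent) explicit slope.  (Inputs: `D̂ → A > 0` geometrically (#1457, «LENGTH-POINTWISE-LAW»), `Ĉ` linear and
`Ĉ²` quadratic with forced leading coefficients («CONTACT ASYMPTOTICS»), the variance algebra `W2.tendsto_ratio_var_sub_linear`, `varRate_identity_three`.)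
[cite: Feller1968, XIII.6 (Var N_k = (σ²/μ³)k + O(1)); DuminilCopinHammond2013, §2.2; lane «pcv-sawmu» a-p2 g29 — own result, not in print] -/
theorem tendsto_varTopThree_sub_linear (a b : Fin (2 * 3)) :
    ∃ V : ℝ, Tendsto (fun k : ℕ => varTopThree (k + 1) a b - varRateHatThree * ((k : ℝ) + 1)) atTop (𝓝 V) := by
  obtain ⟨m₀, m₂, K, hb₁, hb₂⟩ := exists_hatC2D_three_quadratic a b
  have hT : tOneThree ≠ 0 := (exists_hatCD_three_linear a b).1
  set A : ℝ := limDThree a b with hA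
  have hApos : 0 < A := limDThree_pos a b
  have hAne : A ≠ 0 := hApos.ne'
  -- the constants of the variance algebra, in (k+1)-indexing
  set μ₁ : ℝ := cThree * A with hμ₁
  set μ₀ : ℝ := m₀ - cThree * A with hμ₀
  set q : ℝ := cThree ^ 2 * A with hq
  set ℓ : ℝ := linQThree A m₀ - 2 * cThree ^ 2 * A with hℓ
  set m : ℝ := m₂ - linQThree A m₀ + cThree ^ 2 * A with hm
  have hqA : q * A = μ₁ ^ 2 := by rw [hq, hμ₁]; ring
  have hD := tendsto_sq_mul_hatD_three_sub a b
  have hC : Tendsto (fun k : ℕ => ((k : ℝ) + 1) * (hatCD (stripYT 3) (k + 1) a b - (μ₁ * ((k : ℝ) + 1) + μ₀))) atTop (𝓝 0) := by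
    have h := Literature.Analysis.tendsto_succ_pow_mul_of_abs_le (e := fun n => hatCD (stripYT 3) (n + 1) a b - (cThree * A * (n : ℝ) + m₀))
      (by norm_num : (0 : ℝ) < 97 / 100) (by norm_num) hb₁ 1
    simp only [pow_one] at h
    refine h.congr fun k => ?_
    rw [hμ₁, hμ₀]; ring
  have hQ : Tendsto (fun k : ℕ => hatC2D (stripYT 3) (k + 1) a b - (q * ((k : ℝ) + 1) ^ 2 + ℓ * ((k : ℝ) + 1) + m)) atTop (𝓝 0) := by
    have h := Literature.Analysis.tendsto_succ_pow_mul_of_abs_le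
      (e := fun n => hatC2D (stripYT 3) (n + 1) a b - (cThree ^ 2 * A * (n : ℝ) ^ 2 + linQThree A m₀ * (n : ℝ) + m₂))
      (by norm_num : (0 : ℝ) < 97 / 100) (by norm_num) hb₂ 0
    simp only [pow_zero, one_mul] at h
    refine h.congr fun k => ?_
    rw [hq, hℓ, hm]; ring
  have h := W2.tendsto_ratio_var_sub_linear (D := fun k => hatD 3 (stripYT 3) (k + 1) a b) (C := fun k => hatCD (stripYT 3) (k + 1) a b)
    (Q := fun k => hatC2D (stripYT 3) (k + 1) a b) hAne hqA hD hC hQ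
  have hrate : (ℓ * A - 2 * μ₁ * μ₀) / A ^ 2 = varRateHatThree := by
    rw [hℓ, hμ₁, hμ₀]; exact varRate_identity_three hT hAne m₀
  rw [hrate] at h
  refine ⟨(m * A - μ₀ ^ 2) / A ^ 2, h.congr fun k => ?_⟩
  simp only [varTopThree, meanTopThree]

/-- Corollary: the variance INCREMENTS converge — `varTopThree (k+2) a b − varTopThree (k+1) a b → σ̂₃²` (`= 0.5513875617…`, twice cell BO-7's `0.2756937809`).
[cite: Feller1968, XIII.6; lane «pcv-sawmu» a-p2 g29] -/
theorem tendsto_varTopThree_succ_sub (a b : Fin (2 * 3)) :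
    Tendsto (fun k : ℕ => varTopThree (k + 2) a b - varTopThree (k + 1) a b) atTop (𝓝 varRateHatThree) := by
  obtain ⟨V, h⟩ := tendsto_varTopThree_sub_linear a b
  have h1 := h.comp (tendsto_add_atTop_nat 1)
  have t := (h1.sub h).add_const varRateHatThree
  rw [sub_self, zero_add] at t
  refine t.congr fun k => ?_
  simp only [Function.comp]
  push_cast
  ring

/-- Corollary: `varTopThree k a b / k → σ̂₃²`. [cite: Feller1968, XIII.6; lane «pcv-sawmu» a-p2 g29] -/
theorem tendsto_varTopThree_div (a b : Fin (2 * 3)) :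
    Tendsto (fun k : ℕ => varTopThree k a b / (k : ℝ)) atTop (𝓝 varRateHatThree) := by
  obtain ⟨V, h⟩ := tendsto_varTopThree_sub_linear a b
  have hinv : Tendsto (fun k : ℕ => ((k : ℝ) + 1)⁻¹) atTop (𝓝 0) := by
    have := (tendsto_one_div_add_atTop_nhds_zero_nat : Tendsto (fun n : ℕ => 1 / ((n : ℝ) + 1)) atTop (𝓝 0))
    simpa using this
  have t := (h.mul hinv).add_const varRateHatThree
  rw [mul_zero, zero_add] at t
  have t' : Tendsto (fun k : ℕ => varTopThree (k + 1) a b / (((k + 1 : ℕ) : ℝ))) atTop (𝓝 varRateHatThree) := by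
    refine t.congr fun k => ?_
    have hk : ((k : ℝ) + 1) ≠ 0 := by positivity
    push_cast
    field_simp
    ring
  exact (tendsto_add_atTop_iff_nat 1).1 t'

/-- `k/(2k + χ_a − χ_b) → 1/2` (plumbing for the per-step statements). [cite: Feller1968, XIII.3; lane plumbing] -/
theorem tendsto_div_hatLen_three (a b : Fin (2 * 3)) :
    Tendsto (fun k : ℕ => (k : ℝ) / ((hatLen k a b : ℤ) : ℝ)) atTop (𝓝 (1 / 2)) := by
  set c : ℝ := ((lchi a : ℤ) : ℝ) - ((lchi b : ℤ) : ℝ) with hc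
  have hinv : Tendsto (fun k : ℕ => ((k : ℝ))⁻¹) atTop (𝓝 0) := tendsto_inv_atTop_zero.comp tendsto_natCast_atTop_atTop
  have t0 : Tendsto (fun k : ℕ => 2 + c * ((k : ℝ))⁻¹) atTop (𝓝 (2 + c * 0)) := (hinv.const_mul c).const_add 2
  rw [mul_zero, add_zero] at t0
  have t : Tendsto (fun k : ℕ => (2 + c * ((k : ℝ))⁻¹)⁻¹) atTop (𝓝 (2⁻¹)) := t0.inv₀ (by norm_num)
  rw [show (1 : ℝ) / 2 = 2⁻¹ by norm_num]
  refine t.congr' ?_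
  filter_upwards [eventually_gt_atTop 0] with k hk
  have hk' : (k : ℝ) ≠ 0 := by exact_mod_cast hk.ne'
  have hlen : ((hatLen k a b : ℤ) : ℝ) = 2 * (k : ℝ) + c := by rw [hc, hatLen]; push_cast; ring
  rw [hlen]
  field_simp

/-- ★★★ **PER STEP** (cell BO-9K of the lane register): a bridge `a → b` of hat index `k` has `hatLen k a b = 2k + χ_a − χ_b` steps, so
`varTopThree k a b / (number of steps) → σ₃² = sigmaSqThree = (c₂ − c²)/2` (`= 0.2756937808635911…`) — the variance rate of the surface-contact count of
the critical width-THREE strip, for every pair of end levels. [cite: Feller1968, XIII.6; DuminilCopinHammond2013, §2.2; lane «pcv-sawmu» a-p2 g29 — own result, not in print] -/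
theorem tendsto_varTopThree_div_hatLen (a b : Fin (2 * 3)) :
    Tendsto (fun k : ℕ => varTopThree k a b / ((hatLen k a b : ℤ) : ℝ)) atTop (𝓝 sigmaSqThree) := by
  have h := tendsto_varTopThree_div a b
  have t := h.mul (tendsto_div_hatLen_three a b)
  have hlim : varRateHatThree * (1 / 2) = sigmaSqThree := by rw [sigmaSqThree]; ring
  rw [hlim] at t
  refine t.congr' ?_
  filter_upwards [eventually_gt_atTop 0] with k hk
  have hk' : (k : ℝ) ≠ 0 := by exact_mod_cast hk.ne'
  field_simp

/-- ★ **The mean per step**: `meanTopThree k a b / (number of steps) → c/2` — the surface-contact DENSITY of the critical width-three strip recovered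
from the hat chain (`c/2 = 0.3303707704 = θ₃` of «WIDTH-THREE-DENSITY» numerically; the algebraic identification is not claimed here).
[cite: Feller1968, XIII.6 (E N_k ∼ k/μ); DuminilCopinHammond2013, §2.2; lane «pcv-sawmu» a-p2 g29 — own result] -/
theorem tendsto_meanTopThree_div_hatLen (a b : Fin (2 * 3)) :
    Tendsto (fun k : ℕ => meanTopThree k a b / ((hatLen k a b : ℤ) : ℝ)) atTop (𝓝 (cThree / 2)) := by
  obtain ⟨_, m₀, K, -, hb⟩ := exists_hatCD_three_linear a b
  set A : ℝ := limDThree a b with hA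
  have hApos : 0 < A := limDThree_pos a b
  have hAne : A ≠ 0 := hApos.ne'
  have hinv : Tendsto (fun k : ℕ => ((k : ℝ) + 1)⁻¹) atTop (𝓝 0) := by
    have := (tendsto_one_div_add_atTop_nhds_zero_nat : Tendsto (fun n : ℕ => 1 / ((n : ℝ) + 1)) atTop (𝓝 0))
    simpa using this
  -- `Ĉ(k+1)/(k+1) → cA` and `D̂(k+1) → A`
  have hC1 : Tendsto (fun k : ℕ => ((k : ℝ) + 1) * (hatCD (stripYT 3) (k + 1) a b - (cThree * A * (k : ℝ) + m₀))) atTop (𝓝 0) := by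
    have h := Literature.Analysis.tendsto_succ_pow_mul_of_abs_le (e := fun n => hatCD (stripYT 3) (n + 1) a b - (cThree * A * (n : ℝ) + m₀))
      (by norm_num : (0 : ℝ) < 97 / 100) (by norm_num) hb 1
    simpa only [pow_one] using h
  have hC0 : Tendsto (fun k : ℕ => hatCD (stripYT 3) (k + 1) a b / ((k : ℝ) + 1)) atTop (𝓝 (cThree * A)) := by
    have t := ((hC1.mul (hinv.mul hinv)).add ((hinv.const_mul (m₀ - cThree * A)).add_const (cThree * A)))
    simp only [mul_zero, zero_add] at t
    refine t.congr fun k => ?_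
    have hk : ((k : ℝ) + 1) ≠ 0 := by positivity
    field_simp
    ring
  have hD0 : Tendsto (fun k : ℕ => hatD 3 (stripYT 3) (k + 1) a b) atTop (𝓝 A) := tendsto_hatD_three_succ a b
  have hq := hC0.div hD0 hAne
  rw [mul_div_assoc, div_self hAne, mul_one] at hq
  -- `meanTop(k+1)/(k+1) → c`, then per step
  have hmean : Tendsto (fun k : ℕ => meanTopThree (k + 1) a b / (((k + 1 : ℕ) : ℝ))) atTop (𝓝 cThree) := by
    refine hq.congr fun k => ?_
    simp only [meanTopThree, Pi.div_apply]
    push_cast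
    rw [div_div, div_div, mul_comm]
  have hmean' : Tendsto (fun k : ℕ => meanTopThree k a b / (k : ℝ)) atTop (𝓝 cThree) := (tendsto_add_atTop_iff_nat 1).1 hmean
  have t := hmean'.mul (tendsto_div_hatLen_three a b)
  rw [show cThree * (1 / 2) = cThree / 2 by ring] at t
  refine t.congr' ?_
  filter_upwards [eventually_gt_atTop 0] with k hk
  have hk' : (k : ℝ) ≠ 0 := by exact_mod_cast hk.ne'
  field_simp

end W3

end HV

end Literature.Probability.RandomPlanarGeometry.SAW
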